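import Mathlib

/-!
# `SmallCaseThreeFive` (stmt-ValiantsHypothesis-5644), line `Sketch` — stub `stub_binomial_eleven`

Binomial bookkeeping for the transfer from the homogeneous ideal membership `c_id ^ 11 ∈ J` to
the inhomogeneous degree-`55` certificate: writing `c_id = 1 + e`, one needs
`(e + 1) ^ 11 = 1 + e * Q` for some `Q` with `Q.totalDegree ≤ 10 * e.totalDegree`.
We prove the general statement `(e + 1) ^ (n + 1) = 1 + e * Q`, `Q.totalDegree ≤ n * e.totalDegree`
by induction on `n` (take `Q₀ = 1` and `Q_{n+1} = Q_n * e + (Q_n + 1)`), using only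
`MvPolynomial.totalDegree_add`, `totalDegree_mul`, `totalDegree_one`, and specialise to `n = 10`.
-/

noncomputable section
set_option linter.dupNamespace false

namespace Summit.ValiantsHypothesis.ValiantsHypothesis.Theorems.RefutationDegreeSmallCaseThreeFive

open MvPolynomial
open scoped BigOperators

/-- For every `n`, `(e + 1) ^ (n + 1) = 1 + e * Q` for some `Q` with
`Q.totalDegree ≤ n * e.totalDegree` (induction on `n`: `Q₀ = 1`, `Q_{n+1} = Q_n * e + (Q_n + 1)`). -/
theorem exists_add_one_pow_succ_eq_one_add_mul {σ : Type*} {R : Type*} [CommRing R]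
    (e : MvPolynomial σ R) (n : ℕ) :
    ∃ Q : MvPolynomial σ R,
      (e + 1) ^ (n + 1) = 1 + e * Q ∧ Q.totalDegree ≤ n * e.totalDegree := by
  induction n with
  | zero => exact ⟨1, by ring, by simp⟩
  | succ n ih =>
    obtain ⟨Q, hQ, hdeg⟩ := ih
    refine ⟨Q * e + (Q + 1), by rw [pow_succ, hQ]; ring, ?_⟩
    refine (totalDegree_add _ _).trans (max_le ?_ ?_)
    · refine (totalDegree_mul _ _).trans ?_
      rw [add_mul, one_mul]
      exact Nat.add_le_add_right hdeg _
    · refine (totalDegree_add _ _).trans (max_le (hdeg.trans ?_) ?_)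
      · exact Nat.mul_le_mul_right _ (Nat.le_succ n)
      · rw [totalDegree_one]
        exact Nat.zero_le _

/-- **Binomial bookkeeping.** For every `e`, `(e + 1) ^ 11 = 1 + e * Q` for some `Q` with
`Q.totalDegree ≤ 10 * e.totalDegree` (the case `n = 10` of
`exists_add_one_pow_succ_eq_one_add_mul`). -/
theorem stub_binomial_eleven {σ : Type*} {R : Type*} [CommRing R] (e : MvPolynomial σ R) :
    ∃ Q : MvPolynomial σ R, (e + 1) ^ 11 = 1 + e * Q ∧ Q.totalDegree ≤ 10 * e.totalDegree :=
  exists_add_one_pow_succ_eq_one_add_mul e 10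

end Summit.ValiantsHypothesis.ValiantsHypothesis.Theorems.RefutationDegreeSmallCaseThreeFive
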